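import Summits.HodgeConjecture.HodgeConjecture.Theorems.NikulinTwinTransportTwinSimilitudeAlgebraicMarkings

/-!
# Route NikulinTwinTransport · crux `TwinTwistorTransport` (stmt-HodgeConjecture-14393) —
# the shared line stub `PeriodInvariance` (re-marking by Buskin)

The transport lines of the crux (`Cruxes/TwinTwistorTransport/Lines/reduced_virtual_count_twin_locus.lean`,
Stub 4 `stub_periodInvariance : PeriodInvariance`; verbatim `stub_periodInvariance` of
`Lines/ordinary_prime_anchors.lean` and Stub 4 of `Lines/semiregular-twin-hodge-locus.lean`) all
consume the same book-keeping statement, registered on the crux item as `stub_periodInvariance`: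

> goodness of ONE marked `M`-twin pair with first period `x` (the twin similitude `η₁⁻¹ ∘ M ∘ η₁′`
> is induced by an algebraic class) passes to EVERY marked `M`-twin pair
> `(S, η, p, x₂; S′, η′, p′, x′)` with `x₂ ∈ ℂ x`,

granted Buskin's theorem (`HodgeIsometryAlgebraic`, route item stmt-HodgeConjecture-13675), the
Hodge types of `H²(K3)` (`Huybrechts_K3_hodgeTypes_H2`, now a theorem of the tree:
`Huybrechts_K3_hodgeTypes_H2_holds`) and the composition of algebraic correspondences between K3
surfaces (`CorrComp`). This file proves it (`stub_periodInvariance`), with the statement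
symbol for symbol the registered stub (same local notations as the line skeletons).

PROOF (Buskin, *J. reine angew. Math.* 755 (2019), §6.2, the re-marking step; Varesco, *Math. Z.*
305 (2023), proof of Thm. 2.1). Write
`η⁻¹ ∘ M ∘ η′ = (η⁻¹ ∘ η₁) ∘ (η₁⁻¹ ∘ M ∘ η₁′) ∘ (η₁′⁻¹ ∘ η′)`.
The middle factor is algebraic by hypothesis. The outer factors are the maps induced between marked
projective K3 surfaces by the IDENTITY of `Λ_ℂ` (`isRationalClass_markingConj`,
`isOfHodgeType_markingConj`, `cupProduct_markingConj` with `ρ = 1`, multiplier `1`): rational,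
isometric for the generators of the markings, and type-preserving because the periods are
proportional — `x = s⁻¹ x₂` for the first factor, and `x′ = (t s / t₁) x₁′` for the last one
(`x′ = N M x′ = t s · N x`, `x₁′ = N M x₁′ = t₁ · N x`, `t₁ ≠ 0` since a period point is non-zero).
Both are algebraic by Buskin's theorem, and the three correspondences compose (`CorrComp`, twice).
-/

noncomputable section

open CategoryTheory MonoidalCategory
open Literature.AlgebraicGeometry.Motives Literature.AlgebraicGeometry.HodgeTheory
open Literature.AlgebraicGeometry.Surfaces
open Literature.AlgebraicTopology.SingularHomology
open Summit.HodgeConjecture.HodgeConjecture.Theses.NikulinTwinTransport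

namespace Summit.HodgeConjecture.HodgeConjecture.Theorems.NikulinTwinTransport

/-! ### Local notations — verbatim the notation blocks A and B of the line skeletons
(`Cruxes/TwinTwistorTransport/Lines/reduced_virtual_count_twin_locus.lean`) -/

/-- `MarkedK3[S, η, p, x]`: a marked K3 surface with period `x` (shape of the conclusion of
`Huybrechts_K3_marking_exists`). Local notation only, verbatim from the line skeleton. -/
local notation3 (prettyPrint := false) "MarkedK3[" S ", " η ", " p ", " x "]" =>
  (IsIntegralClass p ∧
    (∀ q : complexBetti S (2 * 2), IsIntegralClass q → ∃ n : ℤ, q = n • p) ∧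
    (∀ c : complexBetti S (2 * 1), IsIntegralClass c ↔ ∃ v : K3Index → ℤ, η c = fun i => (v i : ℂ)) ∧
    (∀ a b : complexBetti S (2 * 1),
        cupProduct (rfl : 2 * 1 + 2 * 1 = 2 * 2) a b = k3Form (η a) (η b) • p) ∧
    IsOfHodgeType 2 S (2 * 1) 2 0 (LinearEquiv.symm η x) ∧
    (∀ τ : complexBetti S (2 * 1), IsOfHodgeType 2 S (2 * 1) 2 0 τ → ∃ t : ℂ, τ = t • LinearEquiv.symm η x))

/-- `PeriodPt[x]`: `(x.x) = 0`, `(x̄.x) > 0`, a positive lattice vector in `x^⊥`. Local notation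
only, verbatim from the line skeleton. -/
local notation3 (prettyPrint := false) "PeriodPt[" x "]" =>
  (k3Form x x = 0 ∧ 0 < (k3Form (star x) x).re ∧
    ∃ u : K3Index → ℤ, k3Form (fun i => (u i : ℂ)) x = 0 ∧ 0 < ∑ i, ∑ j, u i * k3Gram i j * u j)

/-- `Corr[μ, S, S', hS, hS' ; γ, y] = [γ]_* y = fst_* (snd^* y ∪ γ)`. Local notation only, verbatim
from the line skeleton. -/
local notation3 (prettyPrint := false) "Corr[" μ ", " S ", " S' ", " hS ", " hS' " ; " γ ", " y "]" =>
  complexGysin μ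
    (IsSmoothProjective.tensor_holds (IsK3Surface.isSmoothProjective hS)
      (IsK3Surface.isSmoothProjective hS'))
    (IsK3Surface.isSmoothProjective hS) (SemiCartesianMonoidalCategory.fst S S')
    (rfl : 2 * 1 + 2 * 2 + 2 * 2 = 2 * 1 + 2 * (2 + 2))
    (cupProduct (rfl : 2 * 1 + 2 * 2 = 2 * 1 + 2 * 2)
      (complexBetti.map (SemiCartesianMonoidalCategory.snd S S') (2 * 1) y) γ)

/-- `Latt[M, N]`: `M` is a rational `2`-similitude of `(Λ_ℂ, k3Form)` with rational two-sided
inverse `N`. Local notation only, verbatim from the line skeleton. -/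
local notation3 (prettyPrint := false) "Latt[" M ", " N "]" =>
  ((∀ v : K3Index → ℤ, ∃ w : K3Index → ℚ, M (fun i => (v i : ℂ)) = fun i => (w i : ℂ)) ∧
    (∀ v : K3Index → ℤ, ∃ w : K3Index → ℚ, N (fun i => (v i : ℂ)) = fun i => (w i : ℂ)) ∧
    M * N = 1 ∧ N * M = 1 ∧
    (∀ a b, k3Form (M a) (M b) = 2 * k3Form a b))

/-- `Good[M, μ, S, S', hS, hS', η, η']`: the twin similitude `η⁻¹ ∘ M ∘ η'` is induced by an
algebraic class. Local notation only, verbatim from the line skeleton. -/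
local notation3 (prettyPrint := false) "Good[" M ", " μ ", " S ", " S' ", " hS ", " hS' ", " η ", " η' "]" =>
  ∃ γ ∈ algebraicClasses (MonoidalCategoryStruct.tensorObj S S') 2,
    ∀ y : complexBetti S' (2 * 1), (η : complexBetti S (2 * 1) ≃ₗ[ℂ] (K3Index → ℂ)).symm
      (M ((η' : complexBetti S' (2 * 1) ≃ₗ[ℂ] (K3Index → ℂ)) y)) = Corr[μ, S, S', hS, hS' ; γ, y]

/-- `GoodPairAt[M, μ, x]`: SOME marked projective `M`-twin pair with first period `x` has an
algebraic twin similitude. Local notation only, verbatim from the line skeleton. -/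
local notation3 (prettyPrint := false) "GoodPairAt[" M ", " μ ", " x "]" =>
  ∃ (S S' : SchemeOver ℂ) (hS : IsK3Surface S) (hS' : IsK3Surface S')
    (η : complexBetti S (2 * 1) ≃ₗ[ℂ] (K3Index → ℂ)) (p : complexBetti S (2 * 2))
    (η' : complexBetti S' (2 * 1) ≃ₗ[ℂ] (K3Index → ℂ)) (p' : complexBetti S' (2 * 2))
    (x' : K3Index → ℂ),
    MarkedK3[S, η, p, x] ∧ PeriodPt[x] ∧ MarkedK3[S', η', p', x'] ∧ PeriodPt[x'] ∧
    (∃ t : ℂ, M x' = t • x) ∧ Good[M, μ, S, S', hS, hS', η, η']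

/-- `CorrComp[]`: composition of algebraic correspondences between K3 surfaces is induced by an
algebraic class (Buskin Lemma 6.3 / Fulton Prop. 16.1.1). Local notation only, verbatim from the
line skeleton. -/
local notation3 (prettyPrint := false) "CorrComp[]" =>
  ∀ (μ : OrientationFamily), μ.HasPoincareDuality →
    ∀ (S S' S'' : SchemeOver ℂ) (hS : IsK3Surface S) (hS' : IsK3Surface S') (hS'' : IsK3Surface S''),
    ∀ γ ∈ algebraicClasses (MonoidalCategoryStruct.tensorObj S S') 2,
    ∀ γ' ∈ algebraicClasses (MonoidalCategoryStruct.tensorObj S' S'') 2,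
    ∃ γ'' ∈ algebraicClasses (MonoidalCategoryStruct.tensorObj S S'') 2,
      ∀ y : complexBetti S'' (2 * 1),
        Corr[μ, S, S'', hS, hS'' ; γ'', y] = Corr[μ, S, S', hS, hS' ; γ, Corr[μ, S', S'', hS', hS'' ; γ', y]]

/-! ### The change of marking between two marked K3 surfaces with proportional periods is algebraic -/

/-- **Re-marking is algebraic (Buskin).** For two marked projective K3 surfaces `(S, η, p, x)` and
`(S₁, η₁, p₁, x₁)` whose periods are proportional (`x₁ = t • x`), the change of marking
`η⁻¹ ∘ η₁ : H²(S₁(ℂ); ℂ) → H²(S(ℂ); ℂ)` is induced by an algebraic class on `S × S₁`, granted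
Buskin's theorem `HodgeIsometryAlgebraic` and the Hodge types of `H²(K3)`: it is the map induced
by the identity of `Λ_ℂ`, hence rational (`isRationalClass_markingConj`), an isometry for the
generators of the markings (`cupProduct_markingConj`) and type-preserving
(`isOfHodgeType_markingConj`, the period condition being the proportionality of the periods).
[cite: Buskin2019, Thm. 1.1 and §6.2] -/
theorem remarking_algebraic (hB : HodgeIsometryAlgebraic) (hHT : Huybrechts_K3_hodgeTypes_H2)
    (μ : OrientationFamily) (hμ : μ.HasPoincareDuality)
    {S S₁ : SchemeOver ℂ} (hS : IsK3Surface S) (hS₁ : IsK3Surface S₁)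
    (η : complexBetti S (2 * 1) ≃ₗ[ℂ] (K3Index → ℂ)) (p : complexBetti S (2 * 2)) (x : K3Index → ℂ)
    (η₁ : complexBetti S₁ (2 * 1) ≃ₗ[ℂ] (K3Index → ℂ)) (p₁ : complexBetti S₁ (2 * 2))
    (x₁ : K3Index → ℂ)
    (hm : MarkedK3[S, η, p, x]) (hx : 0 < (k3Form (star x) x).re)
    (hm₁ : MarkedK3[S₁, η₁, p₁, x₁]) (hx₁ : 0 < (k3Form (star x₁) x₁).re)
    (hprop : ∃ t : ℂ, x₁ = t • x) :
    ∃ γ ∈ algebraicClasses (MonoidalCategoryStruct.tensorObj S S₁) 2,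
      ∀ y : complexBetti S₁ (2 * 1), η.symm (η₁ y) = Corr[μ, S, S₁, hS, hS₁ ; γ, y] := by
  -- the identity of `Λ_ℂ` is a rational similitude of multiplier `1`
  have h1rat : ∀ v : K3Index → ℤ, ∃ w : K3Index → ℚ,
      (1 : Module.End ℂ (K3Index → ℂ)) (fun i => (v i : ℂ)) = fun i => (w i : ℂ) :=
    fun v => ⟨fun i => (v i : ℚ), by rw [Module.End.one_apply]; funext i; exact (Rat.cast_intCast _).symm⟩
  have h1iso : ∀ a b, k3Form ((1 : Module.End ℂ (K3Index → ℂ)) a) ((1 : Module.End ℂ (K3Index → ℂ)) b) =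
      1 * k3Form a b := fun a b => by
    rw [Module.End.one_apply, Module.End.one_apply, one_mul]
  have hper : ∃ t : ℂ, (1 : Module.End ℂ (K3Index → ℂ)) x₁ = t • x := by
    obtain ⟨t, ht⟩ := hprop
    exact ⟨t, by rw [Module.End.one_apply, ht]⟩
  have hp₁0 : p₁ ≠ 0 := generator_ne_zero hS₁ hm₁.2.1
  -- the change of marking, written through the identity of `Λ_ℂ`
  set φ : complexBetti S₁ (2 * 1) →ₗ[ℂ] complexBetti S (2 * 1) :=
    η.symm.toLinearMap ∘ₗ (1 : Module.End ℂ (K3Index → ℂ)) ∘ₗ η₁.toLinearMap with hφdef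
  have hφapp : ∀ y, φ y = η.symm ((1 : Module.End ℂ (K3Index → ℂ)) (η₁ y)) := fun y => rfl
  have hφrat : ∀ y, IsRationalClass y → IsRationalClass (φ y) := fun y hy => by
    rw [hφapp]
    exact isRationalClass_markingConj η η₁ 1 hS hS₁ hm.2.2.1 hm₁.2.2.1 h1rat hy
  have hφtype : ∀ (i j : ℕ) (y : complexBetti S₁ (2 * 1)),
      IsOfHodgeType 2 S₁ (2 * 1) i j y → IsOfHodgeType 2 S (2 * 1) i j (φ y) := fun i j y hy => by
    rw [hφapp]
    exact isOfHodgeType_markingConj η p x η₁ p₁ x₁ 1 hHT hS hS₁ hm.2.2.1 hm.2.2.2.1 hm.2.2.2.2.1 hx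
      hm₁.2.2.1 hm₁.2.2.2.1 hp₁0 hm₁.2.2.2.2.1 hx₁ h1rat one_ne_zero h1iso hper i j y hy
  have hφiso : ∀ (y z : complexBetti S₁ (2 * 1)) (a : ℂ),
      cupProduct (rfl : 2 * 1 + 2 * 1 = 2 * 2) y z = a • p₁ →
        cupProduct (rfl : 2 * 1 + 2 * 1 = 2 * 2) (φ y) (φ z) = a • p := fun y z a h => by
    rw [hφapp, hφapp, cupProduct_markingConj η p η₁ p₁ 1 hp₁0 hm.2.2.2.1 hm₁.2.2.2.1 h1iso y z a h,
      one_mul]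
  obtain ⟨γ, hγ, hγeq⟩ := hB μ hμ S S₁ hS hS₁ p p₁ ⟨hm.1, hm.2.1⟩ ⟨hm₁.1, hm₁.2.1⟩ φ hφrat hφtype hφiso
  refine ⟨γ, hγ, fun y => ?_⟩
  have h := hγeq y
  rw [hφapp, Module.End.one_apply] at h
  exact h

/-! ### The stub: goodness passes between marked `M`-twin pairs with proportional periods -/

/-- **`PeriodInvariance` — the shared line stub `stub_periodInvariance` of the transport lines of
the crux `TwinTwistorTransport`, proved.** For a rational lattice `2`-similitude `M` with rational
two-sided inverse `N` (`Latt[M, N]`), granted Buskin's theorem (`HodgeIsometryAlgebraic`), the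
Hodge types of `H²(K3)` and the composition of correspondences (`CorrComp[]`): if SOME marked
projective `M`-twin pair with first period `x` has an algebraic twin similitude
(`GoodPairAt[M, μ, x]`), then so does EVERY marked `M`-twin pair `(S, η, p, x₂; S', η', p', x')`
(`M x' ∈ ℂ x₂`) with `x₂ ∈ ℂ x`. Proof: `η⁻¹ M η' = (η⁻¹ η₁) ∘ (η₁⁻¹ M η₁') ∘ (η₁'⁻¹ η')`; the
outer factors are changes of marking between marked K3 surfaces with proportional periods
(`x = s⁻¹ x₂`; `x' = (t s / t₁) x₁'` from `x' = N M x'`, `x₁' = N M x₁'`), algebraic by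
`remarking_algebraic` (Buskin); the middle factor is algebraic by hypothesis; compose twice.
[cite: Buskin2019, Thm. 1.1 and §6.2 (Lemma 6.3)] [cite: Varesco2023, §2 (proof of Thm. 2.1)] -/
theorem stub_periodInvariance :
    ∀ (M N : Module.End ℂ (K3Index → ℂ)), Latt[M, N] →
      ∀ (μ : OrientationFamily), μ.HasPoincareDuality →
        HodgeIsometryAlgebraic → Huybrechts_K3_hodgeTypes_H2 → CorrComp[] →
        ∀ (x : K3Index → ℂ), GoodPairAt[M, μ, x] →
          ∀ (S S' : SchemeOver ℂ) (hS : IsK3Surface S) (hS' : IsK3Surface S')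
            (η : complexBetti S (2 * 1) ≃ₗ[ℂ] (K3Index → ℂ)) (p : complexBetti S (2 * 2)) (x₂ : K3Index → ℂ)
            (η' : complexBetti S' (2 * 1) ≃ₗ[ℂ] (K3Index → ℂ)) (p' : complexBetti S' (2 * 2)) (x' : K3Index → ℂ),
            MarkedK3[S, η, p, x₂] → PeriodPt[x₂] → MarkedK3[S', η', p', x'] → PeriodPt[x'] →
            (∃ t : ℂ, M x' = t • x₂) → (∃ s : ℂ, x₂ = s • x) →
            Good[M, μ, S, S', hS, hS', η, η'] := by
  intro M N hL μ hμ hB hHT hcomp x hgood S S' hS hS' η p x₂ η' p' x' hm hx₂ hm' hx' hper hprop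
  obtain ⟨-, -, -, hNM, -⟩ := hL
  obtain ⟨S₁, S₁', hS₁, hS₁', η₁, p₁, η₁', p₁', x₁', hm₁, hx, hm₁', hx₁', hper₁, γ₁, hγ₁, hγ₁eq⟩ := hgood
  obtain ⟨t, ht⟩ := hper
  obtain ⟨s, hs⟩ := hprop
  obtain ⟨t₁, ht₁⟩ := hper₁
  -- the proportionality constants are invertible: period points are non-zero
  have hNMx : ∀ z, N (M z) = z := fun z => by
    rw [← Module.End.mul_apply, hNM, Module.End.one_apply]
  have hs0 : s ≠ 0 := by
    rintro rfl
    rw [zero_smul] at hs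
    exact ne_zero_of_star_self_re_pos hx₂.2.1 hs
  have hx'eq : x' = (t * s) • N x := by
    calc x' = N (M x') := (hNMx x').symm
      _ = (t * s) • N x := by rw [ht, hs, map_smul, map_smul, smul_smul]
  have hx₁'eq : x₁' = t₁ • N x := by
    calc x₁' = N (M x₁') := (hNMx x₁').symm
      _ = t₁ • N x := by rw [ht₁, map_smul]
  have ht₁0 : t₁ ≠ 0 := by
    rintro rfl
    rw [zero_smul] at hx₁'eq
    exact ne_zero_of_star_self_re_pos hx₁'.2.1 hx₁'eq
  -- (A) the change of marking `η⁻¹ ∘ η₁ : H²(S₁) → H²(S)` is algebraic (periods `x = s⁻¹ x₂`)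
  obtain ⟨γA, hγA, hγAeq⟩ := remarking_algebraic hB hHT μ hμ hS hS₁ η p x₂ η₁ p₁ x hm hx₂.2.1 hm₁
    hx.2.1 ⟨s⁻¹, by rw [hs, smul_smul, inv_mul_cancel₀ hs0, one_smul]⟩
  -- (C) the change of marking `η₁'⁻¹ ∘ η' : H²(S') → H²(S₁')` is algebraic (periods `x' = (t s / t₁) x₁'`)
  obtain ⟨γC, hγC, hγCeq⟩ := remarking_algebraic hB hHT μ hμ hS₁' hS' η₁' p₁' x₁' η' p' x' hm₁'
    hx₁'.2.1 hm' hx'.2.1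
    ⟨t * s * t₁⁻¹, by rw [hx₁'eq, smul_smul, inv_mul_cancel_right₀ ht₁0, hx'eq]⟩
  -- (B) the middle factor is algebraic by hypothesis; compose twice
  obtain ⟨γ₂, hγ₂, hγ₂eq⟩ := hcomp μ hμ S₁ S₁' S' hS₁ hS₁' hS' γ₁ hγ₁ γC hγC
  obtain ⟨γ, hγ, hγeq⟩ := hcomp μ hμ S S₁ S' hS hS₁ hS' γA hγA γ₂ hγ₂
  refine ⟨γ, hγ, fun y => ?_⟩
  have key : η.symm (M (η' y)) = η.symm (η₁ (η₁.symm (M (η₁' (η₁'.symm (η' y)))))) := by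
    rw [LinearEquiv.apply_symm_apply, LinearEquiv.apply_symm_apply]
  rw [key, hγAeq, hγ₁eq, hγCeq, hγeq y, hγ₂eq y]

end Summit.HodgeConjecture.HodgeConjecture.Theorems.NikulinTwinTransport

end
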